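import Summits.HodgeConjecture.CorCM.CMWeilSectionSqrt
import Summits.HodgeConjecture.CorCM.WeilFourfoldOfMarkmanPlane
import HarnessLib

/-!
# The Weil eigen-line of a Weil section: `H^{2m}(B)_S ⊆ ⋀^{2m} V₊` for `φ_S = ⊕_i ι_i(a_i)`, `φ_S² = -d`

Cell `pub-hodgecm2` (COR-CM), count-neutral sub-row A3-CM45-products, file 2b (sequel of `CorCM/CMWeilSectionSqrt`).
HONEST FRAMING: structure theorems about products of CM abelian varieties; no case of the Hodge conjecture is proved
here and `HC_CM` is never asserted.

For realisations `(A_i, ι_i, θ_i)` of CM types `Φ_i` of CM fields `K_i` on `H¹`, `B = ⨁_i A_i`, and a WEIL SECTION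
`S ∈ pohlmannSetsAlg Φ m` (no conjugate pair inside, every conjugate pair met, `τ • S ∈ {S, ρ • S}` for all
`τ ∈ Aut(ℂ)`), the elements `a_i ∈ 𝓞_{K_i}` of `CMWeights.exists_sqrt_neg_of_weilSection` (`s(a_i) = ± i√d` according
as `(i, s) ∈ S` or not) give the endomorphism `φ_S = ⊕_i ι_i(a_i)` of `B`:

* `biproduct_map_comp_self_eq_neg` — `φ_S ≫ φ_S = -(d • 𝟙 B)`;
* **`weightClassesAlg_le_weilClassesPlus_of_weilSection`** — the weight line `H^{2m}(B)_S`
  (`Pohlmann1968.weightClassesAlg A ι (2m) S = ℂ · w_S`, Milne 1.2 (a)) lies in the `+`-Weil eigen-line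
  `weilClassesPlus B φ_S m d` (`⋀^{2m} V₊`, van Geemen 4.9: each `w_{(i,s)}`, `(i,s) ∈ S`, is an `i√d`-eigenvector of
  `φ_S^*`), and contains a non-zero class of Hodge type `(m, m)` (`|S ∩ Φ| = m = |S ∖ Φ|`).

Consumer: `CorCM/CMProductFourfoldsOfMarkman` (total dimension `4`, `m = 2`: Markman's theorem on the Weil plane of
`(B, φ_S)` makes the line algebraic).

## References

* [vanGeemen1994HodgeAV] B. van Geemen, LNM 1594, 4.9 and proof of Thm. 6.12.
* [Milne2020HodgeClassesAV] J. S. Milne, *Hodge classes on abelian varieties* (2020), 1.2 (a).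
* [MoonenZarhin1999LowDim] B. Moonen, Yu. Zarhin, Math. Ann. 315 (1999), Thm. 0.1 and (1.9).
-/

noncomputable section

open CategoryTheory CategoryTheory.Limits NumberField

namespace Summit.HodgeConjecture.CorCM.CMWeights

open Literature.AlgebraicGeometry.Motives (AbelianVariety CMType IsSmoothProjective ComplexPoints)
open Literature.AlgebraicGeometry.HodgeTheory
open Literature.AlgebraicGeometry.Pohlmann1968
open Literature.AlgebraicGeometry.ComplexMultiplication (IsCMTypeRealisation)
open Literature.AlgebraicTopology.SingularHomology
open Literature.NumberTheory.ComplexMultiplication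

open scoped Classical Pointwise

/-! ### §3 The endomorphism `φ_S = ⊕_i ι_i(a_i)` and the Weil eigen-line of the weight `S` -/

section Geometry

variable {n : ℕ} {K : Fin n → Type} [∀ i, Field (K i)] [∀ i, NumberField (K i)]
variable {A : Fin n → AbelianVariety ℂ} {Φ : ∀ i, CMType (K i)} {ι : ∀ i, 𝓞 (K i) →+* End (A i)}
  {θ : ∀ i, K i →+* Module.End ℂ (complexBetti (A i).X 1)}

omit [∀ i, NumberField (K i)] in
/-- `(⊕_i ι_i(a_i))² = -d` on `⨁_i A_i` when `a_i² = -d` in every `𝓞_{K_i}` (componentwise, `biproduct.hom_ext`).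
[folklore] -/
theorem biproduct_map_comp_self_eq_neg (a : ∀ i, 𝓞 (K i)) {d : ℕ} (ha : ∀ i, a i * a i = -(d : 𝓞 (K i))) :
    (biproduct.map fun i => ι i (a i)) ≫ (biproduct.map fun i => ι i (a i)) = -(d • 𝟙 (⨁ A)) := by
  apply biproduct.hom_ext
  intro j
  have hj : ι j (a j) ≫ ι j (a j) = -(d • 𝟙 (A j)) :=
    WeilFourfold.comp_self_eq_neg_of_sq_eq_neg (ι j) (by rw [sq]; exact ha j)
  rw [Category.assoc, biproduct.map_π, biproduct.map_π_assoc, hj]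
  simp

/-- **The Weil eigen-line of a Weil section.**  Let `(A_i, ι_i, θ_i)` realise CM types `Φ_i` of CM fields `K_i`
on `H¹`, `B = ⨁_i A_i`, and let `S ∈ pohlmannSetsAlg Φ m` (a balanced `2m`-subset of `⊔_i Hom(K_i, ℂ)`) be a WEIL
SECTION (no conjugate pair inside, every conjugate pair met, `τ • S ∈ {S, ρ • S}` for all `τ ∈ Aut(ℂ)`).  Then for the
`d ≥ 1` and `a_i ∈ 𝓞_{K_i}` of `exists_sqrt_neg_of_weilSection` (`a_i² = -d`), the endomorphism
`φ_S = ⊕_i ι_i(a_i)` of `B` satisfies `φ_S² = -d`, and the weight line `H^{2m}(B)_S` (`weightClassesAlg A ι (2m) S`,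
the line `ℂ · w_S` of the cup monomial of the eigenvectors indexed by `S`, Milne 1.2 (a)) lies in the `+`-Weil
eigen-line `weilClassesPlus B φ_S m d` (`(x + yφ_S)^* = (x + y i√d)^{2m}` on it: every `w_{(i,s)}`, `(i,s) ∈ S`, is an
`i√d`-eigenvector of `φ_S^*`, van Geemen 4.9 «`⋀^{2n} W`»), and contains a NON-ZERO class of Hodge type `(m, m)`
(`|S ∩ Φ| = m = |S ∖ Φ|`).  [cite: vanGeemen1994HodgeAV, 4.9 and proof of Thm. 6.12]
[cite: Milne2020HodgeClassesAV, 1.2 (a)] -/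
theorem weightClassesAlg_le_weilClassesPlus_of_weilSection
    (hA : ∀ i, IsCMTypeRealisation (Φ i) (A i) (ι i) (θ i)) {m : ℕ} {S : Finset ((i : Fin n) × (K i →+* ℂ))}
    (hS : S ∈ pohlmannSetsAlg Φ m) (hS0 : S.Nonempty) (hsec : ∀ x ∈ S, (starRingAut : ℂ ≃+* ℂ) • x ∉ S)
    (hfull : ∀ x : (i : Fin n) × (K i →+* ℂ), x ∈ S ∨ (starRingAut : ℂ ≃+* ℂ) • x ∈ S)
    (hW : ∀ τ : ℂ ≃+* ℂ, τ • S = S ∨ τ • S = (starRingAut : ℂ ≃+* ℂ) • S) :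
    ∃ (d : ℕ) (a : ∀ i, 𝓞 (K i)), 0 < d ∧ (∀ i, a i * a i = -(d : 𝓞 (K i))) ∧
      (biproduct.map fun i => ι i (a i)) ≫ (biproduct.map fun i => ι i (a i)) = -(d • 𝟙 (⨁ A)) ∧
      weightClassesAlg A ι (2 * m) S ≤ weilClassesPlus (⨁ A) (biproduct.map fun i => ι i (a i)) m d ∧
      ∃ c ∈ weightClassesAlg A ι (2 * m) S, c ≠ 0 ∧ IsOfHodgeType (⨁ A).dim (⨁ A).X (2 * m) m m c := by
  obtain ⟨d, a, hd, hval, -, hsq⟩ := exists_sqrt_neg_of_weilSection hS0 hsec hfull hW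
  refine ⟨d, a, hd, hsq, biproduct_map_comp_self_eq_neg a hsq, ?_⟩
  letI : LinearOrder ((i : Fin n) × (K i →+* ℂ)) :=
    LinearOrder.lift' (Fintype.equivFin _) (Fintype.equivFin _).injective
  obtain ⟨w, hw, hw10, hw01⟩ := exists_eigenbasis_biproduct hA
  obtain ⟨b, hb⟩ := exists_monomialBasis w (2 * m)
  have hb' : ∀ s, b s = cupMonomial w (2 * m) s := fun s => hb s
  let u : Set.powersetCard ((i : Fin n) × (K i →+* ℂ)) (2 * m) := Set.powersetCard.ofCard hS.1
  have hline : weightClassesAlg A ι (2 * m) S = ℂ ∙ b u := weightClassesAlg_eq_span_singleton hw hb' u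
  -- every `w_x`, `x ∈ S`, is an `i√d`-eigenvector of `φ_S^*`
  have heig : ∀ j : Fin (2 * m), w (Set.powersetCard.ofFinEmbEquiv.symm u j) ∈
      Module.End.eigenspace (complexBetti.map (biproduct.map fun i => ι i (a i)).hom.hom.hom 1).hom
        (Complex.I * (Real.sqrt d : ℂ)) := by
    intro j
    have hmem : Set.powersetCard.ofFinEmbEquiv.symm u j ∈ S :=
      (Set.powersetCard.mem_range_ofFinEmbEquiv_symm_iff_mem u _).1 ⟨j, rfl⟩
    rw [Module.End.mem_eigenspace_iff]
    change complexBetti.map (biproduct.map fun i => ι i (a i)).hom.hom.hom 1 (w _) = _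
    rw [hw a, hval _ hmem]
  have hplus : b u ∈ weilClassesPlus (⨁ A) (biproduct.map fun i => ι i (a i)) m d := by
    rw [hb u]
    exact WeilFourfold.cupPowOne_mem_weilClassesPlus _ _ heig
  refine ⟨?_, b u, ?_, b.ne_zero u, ?_⟩
  · rw [hline]
    exact (Submodule.span_singleton_le_iff_mem _ _).2 hplus
  · rw [hline]; exact Submodule.mem_span_singleton_self _
  · -- Hodge type `(m, m)`: `|S ∩ Φ| = m = |S ∖ Φ|`
    have hX : IsSmoothProjective (⨁ A).dim (⨁ A).X := AbelianVariety.isSmoothProjective_holds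
    have h := isOfHodgeType_monomial hX hb (fun x => x.2 ∈ (Φ x.1).1) hw10 hw01 u
    have h1 := hS.2 (RingEquiv.refl ℂ)
    have hcomp : ∀ x : (i : Fin n) × (K i →+* ℂ), ((RingEquiv.refl ℂ : ℂ ≃+* ℂ) : ℂ →+* ℂ).comp x.2 = x.2 :=
      fun x => RingHom.ext fun _ => rfl
    simp only [hcomp] at h1
    have h2 := hS.2.card_eq_two_mul
    rw [hS.1] at h2
    have hP : {x | x ∈ (u : Finset ((i : Fin n) × (K i →+* ℂ))) ∧ x.2 ∈ (Φ x.1).1}.ncard = m := by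
      change {x | x ∈ S ∧ x.2 ∈ (Φ x.1).1}.ncard = m
      omega
    have hN : {x | x ∈ (u : Finset ((i : Fin n) × (K i →+* ℂ))) ∧ ¬ x.2 ∈ (Φ x.1).1}.ncard = m := by
      change {x | x ∈ S ∧ x.2 ∉ (Φ x.1).1}.ncard = m
      omega
    rw [hP, hN] at h
    exact h

end Geometry

end Summit.HodgeConjecture.CorCM.CMWeights

end
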